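import Literature.MathematicalPhysics.QuantumLattice.KomaPiFluxSumRule
import HarnessLib

/-!
# The `U(1)` `η`-rotation symmetry at `B = 0` (Koma 2022, (3.11)): `⟨Γ¹_xΓ¹_y⟩ = ⟨Γ²_xΓ²_y⟩`

T. Koma, *Nambu–Goldstone modes for superconducting lattice fermions*, arXiv:2201.13135 (2022)
[Koma2022], (3.11): `e^{-iπΓ³_x/4} Γ¹_x e^{iπΓ³_x/4} = Γ²_x`, `e^{-iπΓ³_x/4} Γ²_x e^{iπΓ³_x/4} = -Γ¹_x`
("the operator `Γ³_x` is the generator of the `U(1)` rotation. Therefore, the operator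
`Σ_x (-1)^{x}Γ¹_x` is also an order parameter"). At `B = 0` and `h = 0` the Hamiltonian is invariant
under the global rotation, so the thermal `Γ¹Γ¹` and `Γ²Γ²` correlations coincide — the input of
Koma's Appendix B, where the nearest-neighbour correlation `E₁` is extracted from the energy.

Implementation: the quarter rotation is realised (up to an irrelevant global phase) by the orbital
gauge transformation `c†_{x↑} ↦ -i c†_{x↑}`, `c†_{x↓} ↦ c†_{x↓}` (`PairHopRP.etaRotPhase`; the
tree's `orbitalPhaseAut`), which maps `Γ⁺ ↦ -iΓ⁺`, `Γ⁻ ↦ iΓ⁻`, hence `Γ¹ ↦ -Γ²`, `Γ² ↦ Γ¹`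
(`etaRot_gammaOne`, `etaRot_gammaTwo`), fixes `K(T)`, the `U` term and `H_pair(g, 0)`
(`etaRot_hamiltonian_zero`), and therefore the Gibbs state (`gibbsState_etaRot`):
`⟨Γ¹_xΓ¹_y⟩_{β} = ⟨Γ²_xΓ²_y⟩_{β}` (`gibbsState_gammaOne_mul_eq`). All PROVED; no named fact.

## References

* [Koma2022] T. Koma, arXiv:2201.13135, (3.9)–(3.11), Appendix A (A.1), Appendix B.
* [Lieb1994] E. H. Lieb, Phys. Rev. Lett. 73 (1994) 2158, p. 3 (gauge transformations).
-/

noncomputable section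

namespace Literature.MathematicalPhysics.QuantumLattice

open Matrix Finset HubbardWave0

namespace PairHopRP

variable {Λ : Type*} [LinearOrder Λ] [Fintype Λ]

/-! ### The quarter `η`-rotation as an orbital gauge transformation -/

/-- The orbital phases of the quarter `η`-rotation: `-i` on the `↑` orbitals, `1` on the `↓` orbitals
(so that `Γ⁺ = c†_↑c†_↓ ↦ -iΓ⁺`, i.e. `e^{-iπΓ³/4}·e^{iπΓ³/4}` up to a global phase). [cite: Koma2022, (3.11)] -/
def etaRotPhase : Fin 2 → Λ → ℂ := fun σ _ => if σ = 0 then -Complex.I else 1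

omit [LinearOrder Λ] [Fintype Λ] in
/-- The rotation phases are unimodular. [cite: Koma2022, (3.11)] -/
theorem norm_etaRotPhase (σ : Fin 2) (x : Λ) : ‖(etaRotPhase σ x : ℂ)‖ = 1 := by
  unfold etaRotPhase
  split_ifs
  · rw [norm_neg, Complex.norm_I]
  · exact norm_one

omit [LinearOrder Λ] [Fintype Λ] in
/-- `g_↑ g_↓ = -i`. [cite: Koma2022, (3.11)] -/
theorem etaRotPhase_prod (x : Λ) : (etaRotPhase 0 x : ℂ) * etaRotPhase 1 x = -Complex.I := by
  simp [etaRotPhase]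

/-- The quarter `η`-rotation `X ↦ W X Wᴴ` as a `⋆`-algebra automorphism of the Fock-space operators.
[cite: Koma2022, (3.11)] -/
def etaRot : Matrix (Finset (Orb Λ)) (Finset (Orb Λ)) ℂ ≃⋆ₐ[ℂ] Matrix (Finset (Orb Λ)) (Finset (Orb Λ)) ℂ :=
  orbitalPhaseAut (g := spinSitePhase (etaRotPhase (Λ := Λ))) (fun _ => norm_etaRotPhase _ _)

/-- Unfolding lemma: `etaRot` is the orbital gauge automorphism with phases `etaRotPhase`.
[cite: Koma2022, (3.11)] [cite: Lieb1994, p. 3] -/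
theorem etaRot_apply (X : Matrix (Finset (Orb Λ)) (Finset (Orb Λ)) ℂ) :
    etaRot X = orbitalPhaseAut (g := spinSitePhase (etaRotPhase (Λ := Λ))) (fun _ => norm_etaRotPhase _ _) X := rfl

/-- `W Γ⁺_x Wᴴ = -iΓ⁺_x`. [cite: Koma2022, (3.11)] -/
theorem etaRot_gammaPlus (x : Λ) : etaRot (gammaPlus x) = (-Complex.I) • gammaPlus x := by
  rw [etaRot_apply, orbitalPhaseAut_gammaPlus, etaRotPhase_prod]

/-- `W Γ⁻_x Wᴴ = iΓ⁻_x`. [cite: Koma2022, (3.11)] -/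
theorem etaRot_gammaMinus (x : Λ) : etaRot (gammaMinus x) = Complex.I • gammaMinus x := by
  rw [etaRot_apply, orbitalPhaseAut_gammaMinus, etaRotPhase_prod, star_neg, Complex.star_def, Complex.conj_I, neg_neg]

/-- **`W Γ¹_x Wᴴ = -Γ²_x`** (Koma's (3.11), second relation, for the inverse rotation). [cite: Koma2022, (3.11)] -/
theorem etaRot_gammaOne (x : Λ) : etaRot (gammaOne x) = -gammaTwo x := by
  rw [gammaOne, map_add, etaRot_gammaPlus, etaRot_gammaMinus, gammaTwo, smul_sub]
  module

/-- **`W Γ²_x Wᴴ = Γ¹_x`** (Koma's (3.11), first relation). [cite: Koma2022, (3.11)] -/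
theorem etaRot_gammaTwo (x : Λ) : etaRot (gammaTwo x) = gammaOne x := by
  rw [gammaTwo, map_smul, map_sub, etaRot_gammaPlus, etaRot_gammaMinus, gammaOne, smul_sub, smul_smul, smul_smul,
    show Complex.I * -Complex.I = 1 by rw [mul_neg, Complex.I_mul_I, neg_neg], Complex.I_mul_I, one_smul, neg_one_smul,
    sub_neg_eq_add]

/-! ### Invariance of the Hamiltonian at `h = 0`, `B = 0` -/

/-- The bond terms of the pair interaction at field `0` are rotation invariant
(`[Γ¹_x-Γ¹_y]² + [Γ²_x-Γ²_y]² ↦ [Γ²_x-Γ²_y]² + [Γ¹_x-Γ¹_y]²`). [cite: Koma2022, (3.5), (3.11)] -/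
theorem etaRot_bondTerm_zero (g : ℝ) (x y : Λ) : etaRot (bondTerm g 0 x y) = bondTerm g 0 x y := by
  rw [bondTerm, map_smul, map_add, map_mul, map_mul, map_add, map_sub, map_sub, map_smul, map_one, etaRot_gammaOne,
    etaRot_gammaOne, etaRot_gammaTwo, etaRot_gammaTwo, Complex.ofReal_zero, zero_smul, add_zero, add_zero]
  congr 1
  rw [add_comm, show -gammaTwo x - -gammaTwo y = -(gammaTwo x - gammaTwo y) by abel, neg_mul_neg]

section Graph

variable (G : SimpleGraph Λ) [DecidableRel G.Adj]

/-- `H_pair(g, 0)` is rotation invariant. [cite: Koma2022, (3.5), (3.11)] -/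
theorem etaRot_pairInteraction_zero (g : ℝ) :
    etaRot (pairInteraction G g (fun _ _ => 0)) = pairInteraction G g (fun _ _ => 0) := by
  unfold pairInteraction
  rw [map_sum]
  refine Finset.sum_congr rfl fun x _ => ?_
  rw [map_sum]
  refine Finset.sum_congr rfl fun y _ => ?_
  split_ifs
  · exact etaRot_bondTerm_zero g x y
  · exact map_zero _

/-- `K(T) + UΣ(n-½)(n-½)` is rotation invariant (the phases cancel on every hopping term).
[cite: Koma2022, (3.11)] [cite: Lieb1994, p. 3] -/
theorem etaRot_peierlsHubbard (T : Fin 2 → Λ → Λ → ℂ) (U : ℝ) :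
    etaRot (peierlsHubbard G T U) = peierlsHubbard G T U := by
  rw [etaRot_apply, orbitalPhaseAut_peierlsHubbard]
  congr 1
  funext σ x y
  unfold etaRotPhase
  split_ifs
  · rw [star_neg, Complex.star_def, Complex.conj_I, neg_neg]
    linear_combination (-T σ x y) * Complex.I_mul_I
  · rw [star_one, one_mul, one_mul]

/-- **The Hamiltonian at `h = 0`, `B = 0` is invariant under the `η`-rotation.** [cite: Koma2022, (3.11)] -/
theorem etaRot_hamiltonian_zero (T : Fin 2 → Λ → Λ → ℂ) (U g : ℝ) :
    etaRot (hamiltonian G T U g (fun _ _ => 0) 0) = hamiltonian G T U g (fun _ _ => 0) 0 := by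
  rw [hamiltonian, map_sub, map_add, map_smul, etaRot_peierlsHubbard, etaRot_pairInteraction_zero, Complex.ofReal_zero,
    zero_smul, zero_smul]

end Graph

/-! ### Invariance of the Gibbs state -/

/-- Invariance of a Gibbs state under a unitary symmetry of the Hamiltonian:
`⟨W A Wᴴ⟩_{β,K} = ⟨A⟩_{β,K}` if `WᴴW = 1` and `W K Wᴴ = K`. [cite: BratteliRobinson1997, §5.3.1] -/
private theorem gibbsState_conj_of_invariant {m : Type*} [Fintype m] [DecidableEq m] (β : ℝ) {K W : Matrix m m ℂ}
    (hWW : Wᴴ * W = 1) (hK : W * K * Wᴴ = K) (A : Matrix m m ℂ) :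
    gibbsState β K (W * A * Wᴴ) = gibbsState β K A := by
  have hcomm : W * K = K * W := by
    calc W * K = W * K * (Wᴴ * W) := by rw [hWW, Matrix.mul_one]
      _ = (W * K * Wᴴ) * W := by simp only [Matrix.mul_assoc]
      _ = K * W := by rw [hK]
  have hc : Commute (gibbsWeight β K) W := by
    have h1 : Commute (-(β : ℂ) • K) W := (Commute.smul_left (show Commute K W from hcomm.symm) _)
    exact h1.exp_left
  rw [gibbsState_apply, gibbsState_apply]
  congr 1
  have e : gibbsWeight β K * (W * A * Wᴴ) = W * (gibbsWeight β K * A) * Wᴴ := by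
    simp only [← Matrix.mul_assoc]
    rw [hc.eq]
  rw [e, Matrix.trace_mul_cycle, hWW, Matrix.one_mul]

/-- **The Gibbs state of a rotation-invariant Hamiltonian is rotation invariant**:
`⟨W A Wᴴ⟩_{β,H} = ⟨A⟩_{β,H}` when `W H Wᴴ = H`. [cite: Koma2022, (3.11)] [cite: BratteliRobinson1997, §5.3.1] -/
theorem gibbsState_etaRot (β : ℝ) {H : Matrix (Finset (Orb Λ)) (Finset (Orb Λ)) ℂ} (hH : etaRot H = H)
    (A : Matrix (Finset (Orb Λ)) (Finset (Orb Λ)) ℂ) : gibbsState β H (etaRot A) = gibbsState β H A := by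
  rw [etaRot_apply, orbitalPhaseAut_apply] at hH ⊢
  exact gibbsState_conj_of_invariant β (conjTranspose_orbitalPhase_mul fun _ => norm_etaRotPhase _ _) hH A

section Graph

variable (G : SimpleGraph Λ) [DecidableRel G.Adj]

/-- **`⟨Γ¹_x Γ¹_y⟩ = ⟨Γ²_x Γ²_y⟩` at `h = 0`, `B = 0`** (the `η`-rotation symmetry (3.11); used in
Koma's Appendix B to read the nearest-neighbour `η` correlation off the energy). [cite: Koma2022, (3.11), App. B] -/
theorem gibbsState_gammaOne_mul_eq (β : ℝ) (T : Fin 2 → Λ → Λ → ℂ) (U g : ℝ) (x y : Λ) :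
    gibbsState β (hamiltonian G T U g (fun _ _ => 0) 0) (gammaOne x * gammaOne y) =
      gibbsState β (hamiltonian G T U g (fun _ _ => 0) 0) (gammaTwo x * gammaTwo y) := by
  rw [← gibbsState_etaRot β (etaRot_hamiltonian_zero G T U g) (gammaOne x * gammaOne y), map_mul, etaRot_gammaOne,
    etaRot_gammaOne, neg_mul_neg]

/-- `⟨Γ²_x⟩ = ⟨Γ¹_x⟩ = 0`-type consequence: `⟨Γ²_x⟩ = ⟨Γ¹_x⟩` and `⟨Γ¹_x⟩ = -⟨Γ²_x⟩`, hence both vanish,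
at `h = 0`, `B = 0`. [cite: Koma2022, (3.11)] -/
theorem gibbsState_gammaTwo_eq_zero (β : ℝ) (T : Fin 2 → Λ → Λ → ℂ) (U g : ℝ) (x : Λ) :
    gibbsState β (hamiltonian G T U g (fun _ _ => 0) 0) (gammaTwo x) = 0 := by
  have h1 := gibbsState_etaRot β (etaRot_hamiltonian_zero G T U g) (gammaTwo x)
  have h2 := gibbsState_etaRot β (etaRot_hamiltonian_zero G T U g) (gammaOne x)
  rw [etaRot_gammaTwo] at h1
  rw [etaRot_gammaOne, map_neg] at h2
  -- `h1 : ⟨Γ¹⟩ = ⟨Γ²⟩`, `h2 : -⟨Γ²⟩ = ⟨Γ¹⟩`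
  have : gibbsState β (hamiltonian G T U g (fun _ _ => 0) 0) (gammaTwo x) =
      -gibbsState β (hamiltonian G T U g (fun _ _ => 0) 0) (gammaTwo x) := by rw [h2, h1]
  exact CharZero.eq_neg_self_iff.mp this

end Graph

end PairHopRP

end Literature.MathematicalPhysics.QuantumLattice

end
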